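import Summits.BirchSwinnertonDyer.BirchSwinnertonDyer.Theorems.UniversalToricDescentRelaxedKummerPairCountStrict
import HarnessLib

/-!
# Route UniversalToricDescent — the TWO-SIDED COUNT of the finite-level link, Poitou–Tate world: over a totally complex number field `L`,
# `#S_{∅,0} · #(Sel/Str_T) · #(Sel/Str_V) ≤ #Sel · ∏_{w ∈ V} #𝓛_w` for the Kummer structures of `E[p^k]` relaxed on `V` and strict on `T`
# (brick 3a of the port stub `stub_residualLinkMult`, line `beta-road` v5 on crux `TwinAlgMuZeroAtThree`, stmt-BirchSwinnertonDyer-24737)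

Lead prover bsd-wall-utd-p1 g23 (`--supports stmt-BirchSwinnertonDyer-24737`). Objects (tree, X11b `KummerPT`): for finite sets `T`, `V` of finite
places of `L` and `A = ` all infinite places, `KO(S) = (kummerRelaxed W n S).selmerGroup` (Kummer off `S`, no condition on `S`),
`Str(S) = (kummerStrict W n S).selmerGroup` (Kummer off `S`, zero on `S`), `Sel := KO(A) ⊇ Str(A)`, `N_T = ⨅_{w ∈ T} ker loc_w`, and the
MIXED group `S_{V,T} := KO(A ∪ V) ⊓ N_T` (no condition on `V ∪ A`, zero on `T`, Kummer elsewhere — on the route: `V` = places above `𝔭` and the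
bad places, `T` = places above `𝔭′`; it contains the transport of the layer residual group `R_{𝔭′}^{Σ₀}(K_n, E[p])`).

* §1 group bookkeeping: `natCard_quotient_addSubgroupOf_mono` (for `B ≤ A`, `#(B ⧸ B ∩ N) ≤ #(A ⧸ A ∩ N)`), Lagrange in two forms;
  §2 `kummerStrict_union_eq_inf_ker` (`Str(T ∪ A) = Str(A) ⊓ N_T`), monotonicity of the Kummer structures.
* §2 **`natCard_mixed_mul_quotients_le`** — from g18's Poitou–Tate identity (`natCard_relaxedQuotient_mul_natCard_strictQuotient_eq` with its
  `T = ∅`): `#S_{V,T} · #(Str(A) ⧸ Str(T ∪ A)) · #(Str(A) ⧸ Str(A ∪ V)) ≤ #KO(A) · ∏_{w ∈ V} #𝓛_w`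
  (Lagrange twice on `KO(A ∪ V)`; the `T`-quotient of `Str(A)` injects into that of `KO(A ∪ V)`). This is the Poitou–Tate content of
  Castella 2017 App. A (A.4)–(A.7) / BCK21 Thm. 4.1 (A.3) at finite level mod `p^k`: «`dim S_{∅,0} ≤ dim Sel + Σ_{w∈P} dim 𝓛_w − rk loc_P − rk loc_{P′}`».
What remains for the Γ_K-world hypothesis `hcount` of `…ResidualLinkOfLayerCount` (p739980): the transport `Φ^M` of g18's
`…RelaxedLayerTransportTorsion(Primary)` (Sel ↔ `selmerTorsionOver`, `Str` ↔ signature-zero classes, `R(Γ_{K_n}) ↪ S_{V,T}`) and the local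
sizes `#𝓛_w = #E(L_w)[p^k]·#(𝓞_w/p^k)`, `Σ_{w∣𝔭} [L_w:ℚ_p] = [L:K]`.

THEOREMS ONLY (no definition, no named fact, no `sorry`); the Poitou–Tate fact enters as the hypothesis `hPT` (a tree THEOREM:
`poitouTate_selmerStructure_duality_holds`). BSD is not advanced by this file.
References: [Castella2017HeegnerBeilinsonFlach] App. A (A.4)–(A.7); [BurungaleCastellaKim2021] Thm. 4.1 (A.3); [Howard2004HeegnerKolyvagin] Thm. 2.1.11;
[MilneADT2006] I Thm. 4.10.
-/

set_option linter.dupNamespace false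
set_option autoImplicit false

noncomputable section
open scoped Classical
open CategoryTheory Field NumberField IsDedekindDomain Function
open Literature.NumberTheory.EllipticCurves Literature.NumberTheory.EllipticCurves.GreenbergSelmer
open Literature.NumberTheory.GaloisRepresentations
open Literature.NumberTheory.GaloisRepresentations.DiscreteGaloisModule (SelmerStructure)
open Literature.NumberTheory.GaloisCohomology
open scoped ContRepresentation

namespace Summit.BirchSwinnertonDyer.BirchSwinnertonDyer.Theorems.UniversalToricDescentTwoSidedLayerCountPT

open Summit.BirchSwinnertonDyer.Rank1Residual.X11b.KummerPT Summit.BirchSwinnertonDyer.Rank1Residual.X11b.LocBridge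
  Summit.BirchSwinnertonDyer.Rank1Residual.X11b.Levels Summit.BirchSwinnertonDyer.Rank1Residual.X11b.AcSelmer
  Summit.BirchSwinnertonDyer.Rank1Residual.X11b.Relaxation Summit.BirchSwinnertonDyer.Rank1Residual.X11b.SelmerLevelBound
  Summit.BirchSwinnertonDyer.BirchSwinnertonDyer.Theorems.UniversalToricDescentRelaxedKummerPairCount

/-! ## §1 Group bookkeeping -/

section Group

variable {G : Type*} [AddCommGroup G]

/-- For `B ≤ A ≤ G` and `N ≤ G`: `B ⧸ (B ∩ N)` injects into `A ⧸ (A ∩ N)`, so `#(B ⧸ B ∩ N) ≤ #(A ⧸ A ∩ N)` (finite `A`). [folklore] -/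
theorem natCard_quotient_addSubgroupOf_mono {A B : AddSubgroup G} (h : B ≤ A) (N : AddSubgroup G) [Finite A] :
    Nat.card (B ⧸ N.addSubgroupOf B) ≤ Nat.card (A ⧸ N.addSubgroupOf A) := by
  let f : B ⧸ N.addSubgroupOf B →+ A ⧸ N.addSubgroupOf A :=
    QuotientAddGroup.map (N.addSubgroupOf B) (N.addSubgroupOf A) (AddSubgroup.inclusion h) fun x hx ↦ by
      rw [AddSubgroup.mem_addSubgroupOf] at hx
      exact AddSubgroup.mem_comap.mpr (AddSubgroup.mem_addSubgroupOf.mpr hx)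
  have hf : Function.Injective f := by
    rw [injective_iff_map_eq_zero]
    intro x hx
    obtain ⟨b, rfl⟩ := QuotientAddGroup.mk'_surjective _ x
    rw [QuotientAddGroup.mk'_apply, QuotientAddGroup.eq_zero_iff, AddSubgroup.mem_addSubgroupOf]
    have hx' : (QuotientAddGroup.mk' (N.addSubgroupOf A)) (AddSubgroup.inclusion h b) = 0 := hx
    rw [QuotientAddGroup.mk'_apply, QuotientAddGroup.eq_zero_iff, AddSubgroup.mem_addSubgroupOf] at hx'
    exact hx'
  exact Nat.card_le_card_of_injective f hf

/-- Lagrange with a smaller subgroup: `#A = #(A ⧸ B) · #B` for `B ≤ A`. [folklore] -/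
theorem natCard_eq_quotient_mul_of_le {A B : AddSubgroup G} (h : B ≤ A) :
    Nat.card A = Nat.card (A ⧸ B.addSubgroupOf A) * Nat.card B := by
  rw [AddSubgroup.card_eq_card_quotient_mul_card_addSubgroup (B.addSubgroupOf A),
    Nat.card_congr (AddSubgroup.addSubgroupOfEquivOfLe h).toEquiv]

/-- Lagrange with an intersection: `#A = #(A ⧸ A ∩ N) · #(A ⊓ N)`. [folklore] -/
theorem natCard_eq_quotient_mul_inf (A N : AddSubgroup G) :
    Nat.card A = Nat.card (A ⧸ N.addSubgroupOf A) * Nat.card ↥(A ⊓ N) := by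
  rw [← AddSubgroup.inf_addSubgroupOf_left, natCard_eq_quotient_mul_of_le (inf_le_left : A ⊓ N ≤ A),
    AddSubgroup.inf_addSubgroupOf_left]

end Group

/-! ## §2 The two-sided count -/

section Count

variable {K : Type} [Field K] [NumberField K] (W : WeierstrassCurve K) [W.IsElliptic] (p k : ℕ) [Fact p.Prime]

omit [W.IsElliptic] [Fact p.Prime] in
/-- `kummerStrict S ≤ kummerRelaxed S′` for ANY two sets (pointwise: `⊥ ≤ ·`, `𝓛_v ≤ ⊤`, `𝓛_v ≤ 𝓛_v`). [folklore] -/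
theorem kummerStrict_le_kummerRelaxed' (n : ℕ) (S S' : Finset (Place K)) :
    kummerStrict W n S ≤ kummerRelaxed W n S' := by
  intro v
  by_cases hv : v ∈ S
  · rw [kummerStrict_of_mem W n S hv]; exact bot_le
  · rw [kummerStrict_of_not_mem W n S hv]
    by_cases hv' : v ∈ S'
    · rw [kummerRelaxed_of_mem W n S' hv']; exact le_top
    · rw [kummerRelaxed_of_not_mem W n S' hv']

omit [W.IsElliptic] [Fact p.Prime] in
/-- `kummerRelaxed` is monotone in the relaxed set (pointwise). [folklore] -/
theorem kummerRelaxed_mono (n : ℕ) {S S' : Finset (Place K)} (h : S ⊆ S') :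
    kummerRelaxed W n S ≤ kummerRelaxed W n S' := by
  intro v
  by_cases hv' : v ∈ S'
  · rw [kummerRelaxed_of_mem W n S' hv']; exact le_top
  · rw [kummerRelaxed_of_not_mem W n S' hv', kummerRelaxed_of_not_mem W n S (fun hv ↦ hv' (h hv))]

omit [W.IsElliptic] [Fact p.Prime] in
/-- Pointwise `≤` of Selmer structures gives `≤` of Selmer groups. [cite: MazurRubin2004, Def. 2.1.1] -/
theorem selmerGroup_mono' (n : ℕ) {𝓕 𝓖 : SelmerStructure (W.torsionGaloisModule (n : ℤ))} (h : 𝓕 ≤ 𝓖) :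
    𝓕.selmerGroup ≤ 𝓖.selmerGroup := fun c hc ↦
  (SelmerStructure.mem_selmerGroup_iff _ c).mpr fun v ↦ h v ((SelmerStructure.mem_selmerGroup_iff _ c).mp hc v)

omit [W.IsElliptic] [Fact p.Prime] in
/-- **`Str(T ∪ S′) = Str(S′) ⊓ ⨅_{w∈T} ker loc_w`**: adding finite places to the strict set cuts the Selmer group by the kernels of the
localisations there. [cite: Howard2004HeegnerKolyvagin, Def. 2.1.1] -/
theorem kummerStrict_union_eq_inf_ker (n : ℕ) (T : Finset (HeightOneSpectrum (𝓞 K))) (S' : Finset (Place K)) :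
    (kummerStrict W n (T.image Sum.inr ∪ S')).selmerGroup =
      (kummerStrict W n S').selmerGroup ⊓ ⨅ w ∈ T,
        (galoisCohomology.localization (W.torsionGaloisModule (n : ℤ)) (Sum.inr w) 1).ker := by
  ext c
  simp only [SelmerStructure.mem_selmerGroup_iff, AddSubgroup.mem_inf, AddSubgroup.mem_iInf, AddMonoidHom.mem_ker]
  constructor
  · intro hc
    refine ⟨fun v ↦ ?_, fun w hw ↦ ?_⟩
    · by_cases hv : v ∈ S'
      · have h := hc v
        rw [kummerStrict_of_mem W n _ (Finset.mem_union_right _ hv)] at h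
        rw [kummerStrict_of_mem W n _ hv]
        exact h
      · rw [kummerStrict_of_not_mem W n _ hv]
        by_cases hvT : v ∈ T.image Sum.inr
        · have h := hc v
          rw [kummerStrict_of_mem W n _ (Finset.mem_union_left _ hvT), AddSubgroup.mem_bot] at h
          rw [h]
          exact AddSubgroup.zero_mem _
        · have h := hc v
          rwa [kummerStrict_of_not_mem W n _ (by rw [Finset.mem_union, not_or]; exact ⟨hvT, hv⟩)] at h
    · have h := hc (Sum.inr w)
      rwa [kummerStrict_of_mem W n _ (Finset.mem_union_left _ (Finset.mem_image_of_mem _ hw)), AddSubgroup.mem_bot] at h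
  · rintro ⟨hS, hT⟩ v
    by_cases hv : v ∈ T.image Sum.inr ∪ S'
    · rw [kummerStrict_of_mem W n _ hv, AddSubgroup.mem_bot]
      rcases Finset.mem_union.mp hv with hvT | hvS
      · obtain ⟨w, hw, rfl⟩ := Finset.mem_image.mp hvT
        exact hT w hw
      · have h := hS v
        rwa [kummerStrict_of_mem W n _ hvS, AddSubgroup.mem_bot] at h
    · rw [Finset.mem_union, not_or] at hv
      rw [kummerStrict_of_not_mem W n _ (by rw [Finset.mem_union, not_or]; exact hv)]
      have h := hS v
      rwa [kummerStrict_of_not_mem W n _ hv.2] at h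

/-- **The two-sided count in the Poitou–Tate world** (module docstring):
`#(KO(A ∪ V) ⊓ N_T) · #(Str(A) ⧸ Str(T ∪ A)) · #(Str(A) ⧸ Str(A ∪ V)) ≤ #KO(A) · ∏_{w∈V} #𝓛_w`, `A` = all infinite places.
[cite: Castella2017HeegnerBeilinsonFlach, App. A (A.4)–(A.7)] [cite: Howard2004HeegnerKolyvagin, Thm. 2.1.11] -/
theorem natCard_mixed_mul_quotients_le (hk : 0 < k) (hK : ∀ w : InfinitePlace K, w.IsComplex)
    (hPT : poitouTate_selmerStructure_duality K) (T V : Finset (HeightOneSpectrum (𝓞 K))) :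
    Nat.card ↥((kummerRelaxed W (p ^ k) (Finset.univ.image Sum.inl ∪ V.image Sum.inr)).selmerGroup ⊓
        ⨅ w ∈ T, (galoisCohomology.localization (W.torsionGaloisModule ((p ^ k : ℕ) : ℤ)) (Sum.inr w) 1).ker) *
      Nat.card (↥(kummerStrict W (p ^ k) (Finset.univ.image Sum.inl)).selmerGroup ⧸
        ((kummerStrict W (p ^ k) (T.image Sum.inr ∪ Finset.univ.image Sum.inl)).selmerGroup).addSubgroupOf
          (kummerStrict W (p ^ k) (Finset.univ.image Sum.inl)).selmerGroup) *
      Nat.card (↥(kummerStrict W (p ^ k) (Finset.univ.image Sum.inl)).selmerGroup ⧸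
        ((kummerStrict W (p ^ k) (Finset.univ.image Sum.inl ∪ V.image Sum.inr)).selmerGroup).addSubgroupOf
          (kummerStrict W (p ^ k) (Finset.univ.image Sum.inl)).selmerGroup) ≤
    Nat.card ↥(kummerRelaxed W (p ^ k) (Finset.univ.image Sum.inl)).selmerGroup *
      ∏ w ∈ V, Nat.card (W.kummerSelmerStructure ((p ^ k : ℕ) : ℤ) (Sum.inr w)) := by
  -- notation
  set A : Finset (Place K) := Finset.univ.image Sum.inl with hA
  set KOA := (kummerRelaxed W (p ^ k) A).selmerGroup with hKOA
  set KOV := (kummerRelaxed W (p ^ k) (A ∪ V.image Sum.inr)).selmerGroup with hKOV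
  set StrA := (kummerStrict W (p ^ k) A).selmerGroup with hStrA
  set N : AddSubgroup (galoisCohomology (W.torsionGaloisModule ((p ^ k : ℕ) : ℤ)) 1) :=
    ⨅ w ∈ T, (galoisCohomology.localization (W.torsionGaloisModule ((p ^ k : ℕ) : ℤ)) (Sum.inr w) 1).ker with hN
  -- g18's Poitou–Tate identity with empty strict set
  have hg18 := natCard_relaxedQuotient_mul_natCard_strictQuotient_eq W p k hk hK hPT ∅ V (Finset.disjoint_empty_left V)
  rw [Finset.image_empty, Finset.empty_union] at hg18
  -- finiteness
  haveI hKOVfin : Finite KOV := by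
    rw [hKOV, selmerGroup_kummerRelaxed]; exact finite_kummerOutside W (p ^ k) _
  have hKOA_le : KOA ≤ KOV :=
    selmerGroup_mono' W (p ^ k) (kummerRelaxed_mono W (p ^ k) Finset.subset_union_left)
  have hStrA_le : StrA ≤ KOV :=
    selmerGroup_mono' W (p ^ k) (kummerStrict_le_kummerRelaxed' W (p ^ k) _ _)
  -- Lagrange twice on `KO(A ∪ V)`
  have hLag1 : Nat.card KOV = Nat.card (KOV ⧸ KOA.addSubgroupOf KOV) * Nat.card KOA :=
    natCard_eq_quotient_mul_of_le hKOA_le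
  have hLag2 : Nat.card KOV = Nat.card (KOV ⧸ N.addSubgroupOf KOV) * Nat.card ↥(KOV ⊓ N) :=
    natCard_eq_quotient_mul_inf KOV N
  -- the `T`-strict quotient of `Str(A)` injects into the `N`-quotient of `KO(A ∪ V)`
  have hTeq : ((kummerStrict W (p ^ k) (T.image Sum.inr ∪ A)).selmerGroup).addSubgroupOf StrA = N.addSubgroupOf StrA := by
    rw [kummerStrict_union_eq_inf_ker W (p ^ k) T A, ← hStrA, ← hN, AddSubgroup.inf_addSubgroupOf_left]
  have hmono : Nat.card (StrA ⧸ ((kummerStrict W (p ^ k) (T.image Sum.inr ∪ A)).selmerGroup).addSubgroupOf StrA) ≤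
      Nat.card (KOV ⧸ N.addSubgroupOf KOV) := by
    rw [hTeq]
    exact natCard_quotient_addSubgroupOf_mono hStrA_le N
  -- assemble
  have key : Nat.card ↥(KOV ⊓ N) * Nat.card (KOV ⧸ N.addSubgroupOf KOV) = Nat.card KOV := by
    rw [mul_comm]; exact hLag2.symm
  calc Nat.card ↥(KOV ⊓ N) *
        Nat.card (StrA ⧸ ((kummerStrict W (p ^ k) (T.image Sum.inr ∪ A)).selmerGroup).addSubgroupOf StrA) *
        Nat.card (StrA ⧸ ((kummerStrict W (p ^ k) (A ∪ V.image Sum.inr)).selmerGroup).addSubgroupOf StrA)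
      ≤ Nat.card ↥(KOV ⊓ N) * Nat.card (KOV ⧸ N.addSubgroupOf KOV) *
        Nat.card (StrA ⧸ ((kummerStrict W (p ^ k) (A ∪ V.image Sum.inr)).selmerGroup).addSubgroupOf StrA) :=
        Nat.mul_le_mul_right _ (Nat.mul_le_mul_left _ hmono)
    _ = Nat.card KOV *
        Nat.card (StrA ⧸ ((kummerStrict W (p ^ k) (A ∪ V.image Sum.inr)).selmerGroup).addSubgroupOf StrA) := by
        rw [key]
    _ = Nat.card KOA * (Nat.card (KOV ⧸ KOA.addSubgroupOf KOV) *
        Nat.card (StrA ⧸ ((kummerStrict W (p ^ k) (A ∪ V.image Sum.inr)).selmerGroup).addSubgroupOf StrA)) := by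
        rw [hLag1]; ring
    _ = Nat.card KOA * ∏ w ∈ V, Nat.card (W.kummerSelmerStructure ((p ^ k : ℕ) : ℤ) (Sum.inr w)) := by
        rw [hg18]

end Count

end Summit.BirchSwinnertonDyer.BirchSwinnertonDyer.Theorems.UniversalToricDescentTwoSidedLayerCountPT

end
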